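import Summits.CriticalPhenomena.PercolationContinuityZ3.Theorems.PercNearOneGluingNoHeavyLowerTailKnQuestion8CoefficientwiseOffCluster
import Mathlib.Tactic.Linarith
import HarnessLib

/-!
# Cross-certification: a point above a type-1 and a type-2 source is a target

Support file (`--supports stmt-CriticalPhenomena-4575`, closed), prover `prim-cplus-coupling` (gen 56).  No definitions, no notations, no named
facts, no sorries; standard axioms.  Memo `prim-cplus-coupling/A5-COUPLING-gen56.md` §1.

Setting of CONJECTURE IET in Hall form (memos gen 42–56): `X(ω)` the red cluster of the root `u` (monotone in the red edge set `ω`), `Y(ω)` the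
blue cluster (antitone), `{0,1}`-valued monotone levels `hᵃ, hᵇ ≤ h`, `kᵃ, kᵇ ≤ k`.  A type-1 source has `hᵃ(X) = 1, hᵇ(Y) = 0` ('h red-only') and a
type-2 source has `kᵃ(X) = 1, kᵇ(Y) = 0` ('k red-only').  The lemma of this file: every configuration `τ ⊇ σ₁ ∪ σ₂` lying above an h-red-only
point `σ₁` and a k-red-only point `σ₂` has BOTH statuses red-only, hence is a join `P₁` if it is a demand point and a supply point `S`
(`h(X) = k(X) = 1`) if it is a supply point — with no `𝐁/𝐃`-certificate needed.  This is the mechanism behind the exact (SAT, all 0/1 levels, all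
up-sets) verdicts of gen 56: on `Θ(3,3,3)`, `Θ(3,3,4)`, `Θ(2,3,4)`, `Θ(2,3,3)`, `Θ(1,3,3)`, `Θ(2,2,3,3)` the Hall targets `L₁ ∪ L₂ ∪ {cross-certified joins}`
suffice ('XVD').
* `Coefficientwise.cross_certification` — abstract form (any monotone `X`, antitone `Y`).
* `Coefficientwise.cross_certification_supply` — with `hᵃ ≤ h`, `kᵃ ≤ k`: `h(X τ) = k(X τ) = 1`.
* `Coefficientwise.cross_certification_cluster` — the cluster form on an arbitrary finite multigraph.
[cite: KozmaNitzan2024, Questions 8–9 (§5.5 p. 36) (context)]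
-/

namespace Summit.CriticalPhenomena.PercolationContinuityZ3.Theorems

open Finset Literature.Probability.Percolation

namespace Coefficientwise

/-- **Cross-certification (abstract).**  `X` monotone, `Y` antitone set-valued maps on configurations, `{0,1}`-valued monotone levels.
If `σ₁ ⊆ τ` is h-red-only (`hᵃ(X σ₁) = 1`, `hᵇ(Y σ₁) = 0`) and `σ₂ ⊆ τ` is k-red-only (`kᵃ(X σ₂) = 1`, `kᵇ(Y σ₂) = 0`), then `τ` is h-red-only and
k-red-only.  [cite: KozmaNitzan2024, Questions 8–9 (§5.5 p. 36) (context)] -/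
theorem cross_certification {ι V : Type*} (X Y : Finset ι → Set V)
    (hX : ∀ ⦃s t : Finset ι⦄, s ⊆ t → X s ⊆ X t) (hY : ∀ ⦃s t : Finset ι⦄, s ⊆ t → Y t ⊆ Y s)
    (ha hb ka kb : Set V → ℝ) (mha : Monotone ha) (mhb : Monotone hb) (mka : Monotone ka) (mkb : Monotone kb)
    (ha01 : ∀ S, ha S = 0 ∨ ha S = 1) (hb01 : ∀ S, hb S = 0 ∨ hb S = 1)
    (ka01 : ∀ S, ka S = 0 ∨ ka S = 1) (kb01 : ∀ S, kb S = 0 ∨ kb S = 1)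
    {σ₁ σ₂ τ : Finset ι} (h₁ : σ₁ ⊆ τ) (h₂ : σ₂ ⊆ τ)
    (hro : ha (X σ₁) = 1 ∧ hb (Y σ₁) = 0) (kro : ka (X σ₂) = 1 ∧ kb (Y σ₂) = 0) :
    ha (X τ) = 1 ∧ ka (X τ) = 1 ∧ hb (Y τ) = 0 ∧ kb (Y τ) = 0 := by
  have e1 : ha (X σ₁) ≤ ha (X τ) := mha (hX h₁)
  have e2 : ka (X σ₂) ≤ ka (X τ) := mka (hX h₂)
  have e3 : hb (Y τ) ≤ hb (Y σ₁) := mhb (hY h₁)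
  have e4 : kb (Y τ) ≤ kb (Y σ₂) := mkb (hY h₂)
  obtain ⟨hro1, hro2⟩ := hro
  obtain ⟨kro1, kro2⟩ := kro
  refine ⟨?_, ?_, ?_, ?_⟩
  · rcases ha01 (X τ) with h | h
    · exfalso; linarith
    · exact h
  · rcases ka01 (X τ) with h | h
    · exfalso; linarith
    · exact h
  · rcases hb01 (Y τ) with h | h
    · exact h
    · exfalso; linarith
  · rcases kb01 (Y τ) with h | h
    · exact h
    · exfalso; linarith

/-- **Cross-certification, supply form.**  Under the hypotheses of `cross_certification` and `hᵃ ≤ h`, `kᵃ ≤ k` (`h, k` `{0,1}`-valued),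
`h(X τ) = k(X τ) = 1`: a supply point above a source of each type is an `S`-target. [cite: KozmaNitzan2024, Questions 8–9 (§5.5 p. 36) (context)] -/
theorem cross_certification_supply {ι V : Type*} (X Y : Finset ι → Set V)
    (hX : ∀ ⦃s t : Finset ι⦄, s ⊆ t → X s ⊆ X t) (hY : ∀ ⦃s t : Finset ι⦄, s ⊆ t → Y t ⊆ Y s)
    (h k ha hb ka kb : Set V → ℝ) (mha : Monotone ha) (mhb : Monotone hb) (mka : Monotone ka) (mkb : Monotone kb)
    (h01 : ∀ S, h S = 0 ∨ h S = 1) (k01 : ∀ S, k S = 0 ∨ k S = 1)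
    (ha01 : ∀ S, ha S = 0 ∨ ha S = 1) (hb01 : ∀ S, hb S = 0 ∨ hb S = 1)
    (ka01 : ∀ S, ka S = 0 ∨ ka S = 1) (kb01 : ∀ S, kb S = 0 ∨ kb S = 1)
    (hah : ∀ S, ha S ≤ h S) (kak : ∀ S, ka S ≤ k S)
    {σ₁ σ₂ τ : Finset ι} (h₁ : σ₁ ⊆ τ) (h₂ : σ₂ ⊆ τ)
    (hro : ha (X σ₁) = 1 ∧ hb (Y σ₁) = 0) (kro : ka (X σ₂) = 1 ∧ kb (Y σ₂) = 0) :
    h (X τ) = 1 ∧ k (X τ) = 1 := by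
  obtain ⟨c1, c2, -, -⟩ := cross_certification X Y hX hY ha hb ka kb mha mhb mka mkb ha01 hb01 ka01 kb01 h₁ h₂ hro kro
  have l1 := hah (X τ)
  have l2 := kak (X τ)
  refine ⟨?_, ?_⟩
  · rcases h01 (X τ) with e | e
    · exfalso; linarith
    · exact e
  · rcases k01 (X τ) with e | e
    · exfalso; linarith
    · exact e

/-- **Cross-certification, cluster form (every finite multigraph).**  With `X(ω) = C_u(ω)` the red cluster and `Y(ω) = C_u(E ∖ ω)` the blue cluster of
the root `u`: if `σ₁ ⊆ τ` is h-red-only and `σ₂ ⊆ τ` is k-red-only (`σ₁, σ₂, τ ⊆ E`), then `τ` is h-red-only and k-red-only — a join `P₁` when it is a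
demand point, an `S`-target when it is a supply point.  [cite: KozmaNitzan2024, Questions 8–9 (§5.5 p. 36) (context)] -/
theorem cross_certification_cluster {ι V : Type*} [DecidableEq ι] (ends : ι → Sym2 V) (E : Finset ι) (u : V)
    (ha hb ka kb : Set V → ℝ) (mha : Monotone ha) (mhb : Monotone hb) (mka : Monotone ka) (mkb : Monotone kb)
    (ha01 : ∀ S, ha S = 0 ∨ ha S = 1) (hb01 : ∀ S, hb S = 0 ∨ hb S = 1)
    (ka01 : ∀ S, ka S = 0 ∨ ka S = 1) (kb01 : ∀ S, kb S = 0 ∨ kb S = 1)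
    {σ₁ σ₂ τ : Finset ι} (h₁ : σ₁ ⊆ τ) (h₂ : σ₂ ⊆ τ)
    (hro : ha (openCluster (ends '' (↑σ₁ : Set ι)) u) = 1 ∧ hb (openCluster (ends '' (↑(E \ σ₁) : Set ι)) u) = 0)
    (kro : ka (openCluster (ends '' (↑σ₂ : Set ι)) u) = 1 ∧ kb (openCluster (ends '' (↑(E \ σ₂) : Set ι)) u) = 0) :
    ha (openCluster (ends '' (↑τ : Set ι)) u) = 1 ∧ ka (openCluster (ends '' (↑τ : Set ι)) u) = 1 ∧
      hb (openCluster (ends '' (↑(E \ τ) : Set ι)) u) = 0 ∧ kb (openCluster (ends '' (↑(E \ τ) : Set ι)) u) = 0 := by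
  refine cross_certification (fun ω => openCluster (ends '' (↑ω : Set ι)) u) (fun ω => openCluster (ends '' (↑(E \ ω) : Set ι)) u)
    ?_ ?_ ha hb ka kb mha mhb mka mkb ha01 hb01 ka01 kb01 h₁ h₂ hro kro
  · intro s t hst
    exact openCluster_image_mono ends hst u
  · intro s t hst
    exact openCluster_image_mono ends (Finset.sdiff_subset_sdiff (le_refl E) hst) u

end Coefficientwise

end Summit.CriticalPhenomena.PercolationContinuityZ3.Theorems
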